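import Summits.QuantumFields.YangMills.Theorems.BalabanUVNodesN11SpaceTruncationSameWitness
import Summits.QuantumFields.YangMills.Theorems.BalabanUVNodesN11SpaceTruncationFibre

/-!
# DAG node N11 — door (d4), SAME-WITNESS EDITION ON THE ITERATED AVERAGING FIBRE: p598184's (γ)∕exposed-witness∕(γ′) faces with the background provisos (parents AND
# children) asked on the CHARGED ITERATED FIBRES only — the child slot identity a.e. in `V′`

HEADER — WORK-UNIT METADATA.  Cell `pub-ymgap`, YM-PLAN Track A (HUMAN RULING D-0062), seat `pub-ymgap-dag-n11-d` (g13; R134 fan-out seat N11 [B14], strategy s2),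
route `BalabanUVNodes`, item K1⁷ `StabilityBAtRecordR13SepCoPH` = stmt-QuantumFields-20542 (helper, `--kind proof --supports 20542 --as helper`, count-neutral).
[III] = [Balaban1988Convergent], [LF-I] = [Balaban1989LargeFieldI].  Over p598184 `…N11SpaceTruncationSameWitness` (re-keyed; proofs verbatim but for the transport lemma and
the a.e. child identity) and g13's `…N11SpaceTruncationFibre` (`hasSect2FormAtZS_spaceTruncR_of_charged_fibre`), `…N11TkIteratedFibreReadingSlot` (`sect2Slot_congr_on_fibre_ae`).

WHY THIS FILE.  dag-n11-w1's THEOREM 1 along the witness chain (`…Sect3SupplyChainBorelBObligations`) consumes p598184's same-witness face, displaying 12a″'s `RegOn` at parents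
and children and def-R's `BgProvisoΛ` over the charged reading supports at levels `k` and `k+1`.  As for the `∃`-faces (g13 FILES 4a–8), 11a's `𝐓` reads its operand for
a.e. top-scale field only on the iterated averaging fibre — at the parent level (the transport) AND at the child (the identity `sect2Slot (truncated) = sect2Slot (t₀)`, now
a.e. in `V′`) — so both provisos are needed on the charged ITERATED FIBRES only; there the junction is the top clause alone (`…N11Data7OnFibre`) and `RegOn` is a theorem in
the ZhPin class (`…N11ReadRegRePinned`).  The sequel `…N11SameWitnessZhPinOfSolvable` cashes that in.

WHAT THIS FILE PROVES (0 `sorry`, 0 `def`).  §1 ★★ `sect2Slot_succ_spaceTruncR_truncTermValues_ae_eq_fibre` ((γ) a.e. in `V′`, background over the child's iterated fibre).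
§2 ★★★ `hasSect2FormAtZS_spaceTruncR_and_clause_succ_of_borelB_of_bgReadChargedFibre` (the witness-exposed face over the charged iterated fibre).  §3 ★★★★
`clause_succ_sameWitness_of_hasSect2FormAtZS_of_borelB_of_bgReadChargedFibre` ((γ′): conclusion VERBATIM p598184, both support sets shrunk by the fibre conjuncts).

HONEST FRAMING.  Helper lane of K1⁷; bookkeeping over tree theorems; nothing of Bałaban's is asserted.  N11 NOT discharged; K1⁷ NOT closed; counts unmoved (typed 28∕28 ·
discharged 5∕27).  One finite four-torus programme at fixed `ε = L^{−K}` — NOT ℝ⁴, NOT OS, NOT a mass gap, NOT Clay.  No `sorry`, `axiom`, `def`, `instance`, `notation`.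
Sources (SHAPE only): [III] Theorem p.245, (2.7) p.255, (2.10) p.256, (2.18) p.257, (2.20)–(2.28) pp.258–259, (2.41)–(2.42) p.261, Thm 1 p.262, (3.24)–(3.25) p.270; [LF-I] (0.2)–(0.3) p.176.
-/

noncomputable section

open MeasureTheory
open scoped BigOperators ENNReal NNReal Matrix.Norms.L2Operator

universe u

namespace Summit.QuantumFields.YangMills.Theorems.BalabanUVNodesN11SpaceTruncationSameWitnessFibre

open Literature.MathematicalPhysics.QuantumFieldTheory.Balaban1983to89 T4Continuum T4NestedCovariance Node00 Node00.Tk DagBinding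
open B15DeterminingSets B8Eq17ClassAkV1 Step B14.Eq227LocalizedTerms B14.Eq225Concrete B10Eq42TorusConstraint
open BalabanUVNodesN11FluctTruncationDefs (IsFluctLocal truncTermValues isFluctLocal_truncTermValues lawsRT_truncTermValues
  action23_sect2ActionDataOfRecord_congr_fluct_of_isFluctLocal)
open BalabanUVNodesN11OpenLocusTruncationDefs BalabanUVNodesN11SpaceTruncationDefs BalabanUVNodesN11SpaceTruncationBorelBDefs BalabanUVNodesN11TkReadingSupport
open BalabanUVNodesN11FluctTruncation (hasSect2FormAtZS_truncTermValues sect2Slot_truncTermValues)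
open BalabanUVNodesN11NoExpansionOldBranchGraph (clause_succ_CoPH_of_Omega_empty_of_pinChi_of_oldBranch_of_clause_of_graph)
open BalabanUVNodesN11OldBranchIntegrableOfDominated (integrable_oldBranch_of_dominated)
open BalabanUVNodesN11OperandRowsOfTermRows (measurable_sect2Operand_of_termRows exists_bound_sect2Operand_of_termBounds)
open BalabanUVNodesN11BackgroundCoPMeasurable (measurable_UbgOfRecord₁₃CoP)
open BalabanUVNodesN11SpaceTruncationBorelB (action23_spaceTruncR_eq_of_mem)
open BalabanUVNodesN11SpaceTruncationFibre (hasSect2FormAtZS_spaceTruncR_of_charged_fibre)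
open BalabanUVNodesN11NoExpansionActionSucc (action23_succ_eq_init_of_Omega_empty seq_init_Ω_eq_of_Omega_empty seq_init_Λ_eq_of_Omega_empty)
open BalabanUVNodesN11NoExpansionDiagonalCoPH (sect2Slot_congr_residual)
open BalabanUVNodesN11SpaceTruncationSameWitness (measurable_re_spaceTruncR_B_comp_of_borel_pos)
open BalabanUVNodesN11TkIteratedFibreReadingSlot (sect2Slot_congr_on_fibre_ae)

/-! ## §1  (γ) on the fibre: the child slot identity a.e. in `V′` -/

section Gamma

variable {F : T4Family} {N : ℕ} [NeZero N]
variable {𝔸 : Type*} [NormedRing 𝔸] [NormedAlgebra ℂ 𝔸] [CompleteSpace 𝔸]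
variable {ν : Stage7Numerics} {M : ℕ} {g : ℕ → ℝ} {K : ℕ}

/-- **★★ (γ, fibre edition) THE CHILD SLOT OF THE TRUNCATED PARENT WITNESS IS THE CHILD SLOT OF THE PARENT WITNESS, a.e. IN `V′`**, at a no-expansion child `s′`
(`Ω_{k+1}(s′) = ∅`, `1 ≤ M`): for `fieldMeasure`-a.e. `V′`, `sect2Slot … s′ (spaceTruncR S k (truncTermValues k t₀)) E U V′ = sect2Slot … s′ t₀ E U V′` PROVIDED the laws of `t₀`
at index `k` on `init s′`, the window, the vacuum in the spaces, and the background `U` IN THE SPACES over the child's ITERATED FIBRE over `V′` (scales `j ≤ k` regular,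
trivial off `bondsIn j (Ω_{j+1})ᶜ`, `avg(𝐖_j) = 𝐖_{j+1}` on `bondsIn (j+1) (Ω_{j+1})ᶜ`; levels `1 ≤ j ≤ k`, domains of `init s′`) — p598184's (γ) with `sect2Slot_congr_on_fibre_ae`
in place of the pointwise reading support: the (2.23) action at length `k+1` equals the length-`k` action of `init s′` for any term values, the space truncation is the
identity on the spaces, the fluctuation truncation above `k` is invisible to `𝐓_{k+1}(s′)`, the slot does not read the residual.
[cite: Balaban1988Convergent, (2.18) p.257, (2.20)–(2.23) p.258, (2.26)–(2.28) p.259, (2.41)–(2.42) p.261, (3.24)–(3.25) p.270] -/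
theorem sect2Slot_succ_spaceTruncR_truncTermValues_ae_eq_fibre (Sg : Sect2.Setting 𝔸 (SU N)) (Rz Rz' : Sect2.Residual (F.P K) 𝔸) (hM : 1 ≤ M) {k : ℕ}
    (W : TkWeights F N (FluctV N) K) (s : SeqOfRecord F ν M g K (k + 1)) (hΩ : s.Ω (k + 1) = ∅)
    (Reg : (j : ℕ) → GaugeField (F.P K) j (SU N) → Prop)
    (hζ : ∀ j, j < k + 1 → ∀ ω : MultiCfg (F.P K) (SU N) (FluctV N), W.ζ j (s.Ω (j + 1))ᶜ ω ≠ 0 → Reg j (ω j).1)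
    (t₀ : Sect2.TermValues (F.P K) 𝔸 (FluctV N) M) (E₀ : ℝ) (U : BgMap F N K)
    (hlaw : Sect2.LawsRT (sect2TowerOfRecord F N (FluctV N) K Sg Rz' s.init t₀) Sg.lf k)
    (hg : ∀ j, 1 ≤ j → j ≤ k → 0 ≤ Sg.flow.g (j - 1) ∧ Sg.flow.g (j - 1) ≤ Sg.lf.γ)
    (h1 : ∀ j, 1 ≤ j → j ≤ k → ∀ X : (Sect2.domSys (F.P K) M j).Dom,
      Sect2.ofBackgroundC Sg.ι (1 : GaugeField (F.P K) 0 (SU N)) ∈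
        Sect2.spaceI Sg Rz' M j (Sect2.domSites (F.P K) M j X) (Sg.lf.alpha0 (Sg.flow.g j)) (Sg.lf.alpha1 (Sg.flow.g j)))
 :
    ∀ᵐ V' ∂fieldMeasure (F.P K) (k + 1) (SU N),
      (∀ Wc : MSField (F.P K) (SU N), Wc (k + 1) = V' → (∀ j, j < k + 1 → Reg j (Wc j)) →
        (∀ j, j < k + 1 → ∀ b : PBond (F.P K) j, b ∉ bondsIn j (s.Ω (j + 1))ᶜ → Wc j b = 1) →
        (∀ j, j < k + 1 → ∀ b : PBond (F.P K) (j + 1), b ∈ bondsIn (j + 1) (s.Ω (j + 1))ᶜ → (avOfRecord F N K j).avg (Wc j) b = Wc (j + 1) b) →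
        ∀ j, 1 ≤ j → j ≤ k → ∀ X : (Sect2.domSys (F.P K) M j).Dom,
        (Sect2.domSites (F.P K) M j X ⊆ s.init.Λ j →
          Sect2.ofBackgroundC Sg.ι (U Wc) ∈ Sect2.spaceI Sg Rz' M j (Sect2.domSites (F.P K) M j X) (Sg.lf.alpha0 (Sg.flow.g j)) (Sg.lf.alpha1 (Sg.flow.g j))) ∧
        (Sect2.admB (F.P K) ν M g s.init.Ω s.init.Λ j (Sect2.domSites (F.P K) M j X) = true →
          Sect2.ofBackgroundC Sg.ι (U Wc) ∈ Sect2.spaceMS Sg Rz' M j (Sect2.domSites (F.P K) M j X) s.init.Ω)) →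
      sect2Slot F N (FluctV N) K Sg Rz W s (spaceTruncR Sg k (truncTermValues k t₀)) E₀ U V' = sect2Slot F N (FluctV N) K Sg Rz W s t₀ E₀ U V' := by
  filter_upwards [sect2Slot_congr_on_fibre_ae ν M g K W Sg Rz' s Reg hζ] with V' hV' hbg
  -- the slot does not read the residual: move to `Rz'` (the one the laws and the spaces are stated for)
  rw [sect2Slot_congr_residual Sg Rz Rz' W s _ E₀ U, sect2Slot_congr_residual Sg Rz Rz' W s t₀ E₀ U]
  -- the fluctuation truncation above `k` is invisible to `𝐓_{k+1}(s′)`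
  rw [← sect2Slot_truncTermValues K Sg Rz' W (le_refl (k + 1)) s t₀ E₀ U]
  -- the space truncation: the operands agree on the child's reading support
  have hlawT : Sect2.LawsRT (sect2TowerOfRecord F N (FluctV N) K Sg Rz' s.init (truncTermValues k t₀)) Sg.lf k :=
    lawsRT_truncTermValues Sg Rz' s.init.Ω t₀ Sg.lf k k hlaw
  refine hV' _ _ E₀ E₀ U U fun a Wc hW hR hoff hfib => ?_
  show Real.exp ((sect2ActionDataOfRecord F N (FluctV N) K Sg Rz' s (spaceTruncR Sg k (truncTermValues k t₀)) a E₀).action23 (k + 1) (U Wc)) =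
    Real.exp ((sect2ActionDataOfRecord F N (FluctV N) K Sg Rz' s (truncTermValues k t₀) a E₀).action23 (k + 1) (U Wc))
  rw [action23_succ_eq_init_of_Omega_empty (S := Sg) (Rz := Rz') hM s hΩ _ a E₀ E₀ (U Wc),
    action23_succ_eq_init_of_Omega_empty (S := Sg) (Rz := Rz') hM s hΩ _ a E₀ E₀ (U Wc)]
  congr 1
  show (Sect2.actionDataOfTerms Sg Rz' ν M g s.init.Ω s.init.Λ (spaceTruncR Sg k (truncTermValues k t₀)) k a E₀).action23 k (U Wc) + (E₀ - E₀) =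
    (Sect2.actionDataOfTerms Sg Rz' ν M g s.init.Ω s.init.Λ (truncTermValues k t₀) k a E₀).action23 k (U Wc) + (E₀ - E₀)
  rw [action23_spaceTruncR_eq_of_mem Sg Rz' ν g s.init.Ω s.init.Λ (truncTermValues k t₀) (le_refl k) a E₀ (U Wc) hlawT hg h1
    (fun j h1j hjk X hX => (hbg Wc hW hR hoff hfib j h1j hjk X).1 hX) (fun j h1j hjk X hadm => (hbg Wc hW hR hoff hfib j h1j hjk X).2 hadm)]

end Gamma

/-! ## §2  The witness-exposed face over the charged iterated fibre -/

section Record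


variable {F : T4Family} {N : ℕ} [NeZero N]

variable (θ : Stage13HParams F N) (p : B12.RunParams)

/-- **★★★ p598184's WITNESS-EXPOSED FACE ON THE CHARGED ITERATED FIBRE** (the background proviso's support set shrunk by the two fibre conjuncts; else VERBATIM): given `(t₀, E₀)` with the §2 form at index `k` and `hBt` at levels
`1 ≤ j ≤ k` (β), the EXPLICIT family `s₀ ↦ spaceTruncR S k (truncTermValues k (t₀ s₀))` with the SAME constants `E₀` has the §2 form at index `k`, and the no-expansion
𝐓-step clause holds for it at every child (rows as p594941). [cite: Balaban1988Convergent, Theorem p.245, Thm 1 p.262, (2.7) p.255, (2.10) p.256, (2.18) p.257, (2.20)–(2.28) pp.258–259, (2.31) p.260, (2.41)–(2.42) p.261, (3.24)–(3.25) p.270; Balaban1989LargeFieldI, (0.2)–(0.3) p.176; Balaban1987RG1, Thm 3 p.264] -/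
theorem hasSect2FormAtZS_spaceTruncR_and_clause_succ_of_borelB_of_bgReadChargedFibre (h : θ.Provisos₁₃CoPH F N) (hU : θ.ZhUnity F N)
    (hθ : θ.Admissible F N) (hpos : θ.s2.Pos) {k : ℕ} (hk : k < p.K) (hM : 1 ≤ θ.τ9.M) (hw : Step.InInterval θ.γ k (gOfRecord₁₃ F N θ.toStage13Params p))
    (cR : ℝ) (Γr : SeqOfRecord F θ.ν θ.τ9.M (gOfRecord₁₃ F N θ.toStage13Params p) p.K k → ℕ → Set (Site (F.P p.K) 0) → Set (Site (F.P p.K) 0))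
    (hreg : ∀ s₀, (θ.zhAt p s₀).RegOn F N (FluctV N) θ.ν cR p (gOfRecord₁₃ F N θ.toStage13Params p) (Γr s₀))
    (hbg : BgProvisoΛ F N p.K (settingOfRecord₁₃ F N θ.toStage13Params p) (θ.Rz p.K) θ.τ9.M k
      (fun s₀ => {Wc | slotsOfRecord F N θ.ν θ.τ9 (EOfRecord₁₃ F N θ.toStage13Params) (wOfRecord₉ F N θ.toStage9Params) θ.ppSel p
          (gOfRecord₁₃ F N θ.toStage13Params p) k s₀ ≠ 0 ∧
        chiSeqOfRecord F N θ.ν θ.τ9.M (gOfRecord₁₃ F N θ.toStage13Params p) p.K k s₀ (Wc k) ≠ 0 ∧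
        (∀ j, j < k → PlaqSmallOn (plaqsOf (pts j (Γr s₀ j (s₀.Ω (j + 1))ᶜ))) (cR * epsOfRecord θ.ν (gOfRecord₁₃ F N θ.toStage13Params p) j) (Wc j)) ∧
        (∀ j, j < k → ∀ b : PBond (F.P p.K) j, b ∉ bondsIn j (s₀.Ω (j + 1))ᶜ → Wc j b = 1) ∧
        (∀ j, j < k → ∀ b : PBond (F.P p.K) (j + 1), b ∈ bondsIn (j + 1) (s₀.Ω (j + 1))ᶜ → (avOfRecord F N p.K j).avg (Wc j) b = Wc (j + 1) b)})
      (UbgOfRecord₁₃CoP F N θ.toStage13Params p k))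
    (t₀ : SeqOfRecord F θ.ν θ.τ9.M (gOfRecord₁₃ F N θ.toStage13Params p) p.K k → Sect2.TermValues (F.P p.K) (MatA N) (FluctV N) θ.τ9.M)
    (E₀ : SeqOfRecord F θ.ν θ.τ9.M (gOfRecord₁₃ F N θ.toStage13Params p) p.K k → ℝ)
    (hform₀ : HasSect2FormAtZS F N (FluctV N) p.K (settingOfRecord₁₃ F N θ.toStage13Params p) k (θ.rzAt p) (WtOfRecord₁₃H F N θ p)
      (UbgOfRecord₁₃CoP F N θ.toStage13Params p k)
      (fun s₀ t' => Sect2.LawsRT (sect2TowerOfRecord F N (FluctV N) p.K (settingOfRecord₁₃ F N θ.toStage13Params p) (θ.rzAt p s₀) s₀ t')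
        (settingOfRecord₁₃ F N θ.toStage13Params p).lf k)
      (slotsOfRecord F N θ.ν θ.τ9 (EOfRecord₁₃ F N θ.toStage13Params) (wOfRecord₉ F N θ.toStage9Params) θ.ppSel p (gOfRecord₁₃ F N θ.toStage13Params p) k) t₀ E₀)
    (hBt : ∀ s₀ (S' : ℕ → Set (Site (F.P p.K) 0)) (j : ℕ) (X : (Sect2.domSys (F.P p.K) θ.τ9.M j).Dom), 1 ≤ j → j ≤ k →
      Measurable (fun q : GaugeField (F.P p.K) 0 (SU N) × MSFluct (F.P p.K) (FluctV N) =>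
        (t₀ s₀).B j X (Sect2.ofBackgroundC (settingOfRecord₁₃ F N θ.toStage13Params p).ι q.1) (S', q.2))) :
    HasSect2FormAtZS F N (FluctV N) p.K (settingOfRecord₁₃ F N θ.toStage13Params p) k (θ.rzAt p) (WtOfRecord₁₃H F N θ p)
          (UbgOfRecord₁₃CoP F N θ.toStage13Params p k)
          (fun s₀ t' => Sect2.LawsRT (sect2TowerOfRecord F N (FluctV N) p.K (settingOfRecord₁₃ F N θ.toStage13Params p) (θ.rzAt p s₀) s₀ t')
            (settingOfRecord₁₃ F N θ.toStage13Params p).lf k)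
          (slotsOfRecord F N θ.ν θ.τ9 (EOfRecord₁₃ F N θ.toStage13Params) (wOfRecord₉ F N θ.toStage9Params) θ.ppSel p
            (gOfRecord₁₃ F N θ.toStage13Params p) k)
          (fun s₀ => spaceTruncR (settingOfRecord₁₃ F N θ.toStage13Params p) k (truncTermValues k (t₀ s₀))) E₀ ∧
      ∀ (s : SeqOfRecord F θ.ν θ.τ9.M (gOfRecord₁₃ F N θ.toStage13Params p) p.K (k + 1)), s.Ω (k + 1) = ∅ →
        -- (P) prefix agreement below `k`
        (∀ j, j < k → (θ.zhAt p s).ζ0 j = (θ.zhAt p s.init).ζ0 j ∧ (θ.zhAt p s).quad j = (θ.zhAt p s.init).quad j) →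
        -- (V) the generation-`k` pin with the old front factor
        (∀ (V' : GaugeField (F.P p.K) (k + 1) (SU N)) (U₀ : GaugeField (F.P p.K) k (SU N)),
          (θ.zhAt p s).ζ0 k Set.univ (pairCfgAt (V := FluctV N) k V' U₀) =
            chiSeqOfRecord F N θ.ν θ.τ9.M (gOfRecord₁₃ F N θ.toStage13Params p) p.K k s.init U₀ *
              wOfRecord₉ F N θ.toStage9Params p (gOfRecord₁₃ F N θ.toStage13Params p) k s U₀ ((avOfRecord F N p.K k).avg U₀)) →
        -- `quad_k(∅) = 0` on the two-scale configurations
        (∀ (V' : GaugeField (F.P p.K) (k + 1) (SU N)) (U₀ : GaugeField (F.P p.K) k (SU N)), (θ.zhAt p s).quad k ∅ (pairCfgAt (V := FluctV N) k V' U₀) = 0) →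
        -- `k`-locality of `quad_j(Λ_{j+1})`, `j < k`
        (∀ j, j < k → ∀ ω ω' : MultiCfg (F.P p.K) (SU N) (FluctV N), (∀ i, i ≤ k → ω i = ω' i) →
          (θ.zhAt p s).quad j (s.init.Λ (j + 1)) ω = (θ.zhAt p s).quad j (s.init.Λ (j + 1)) ω') →
        -- measurability of the residual serving `s′`
        (∀ j (Y : Set (Site (F.P p.K) 0)), Measurable ((θ.zhAt p s).ζ0 j Y)) →
        (∀ j (Λ' : Set (Site (F.P p.K) 0)), Measurable ((θ.zhAt p s).quad j Λ')) →
        -- per old branch: A-fibre domination (K0b)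
        (∀ S ∈ admSOfRecord F θ.ν θ.τ9.M (gOfRecord₁₃ F N θ.toStage13Params p) p.K k s.init, ∀ j : ℕ,
          ∃ ŵ : (↥(Set.toFinite (B10Eq42TorusConstraint.bondsIn j ((s.init.Λ (j + 1))ᶜ ∩ s.init.Ω (j + 1)))).toFinset → FluctV N) → ℝ≥0∞, Measurable ŵ ∧
            (∫⁻ a, ŵ a ∂(Measure.pi fun _ : ↥(Set.toFinite (B10Eq42TorusConstraint.bondsIn j ((s.init.Λ (j + 1))ᶜ ∩ s.init.Ω (j + 1)))).toFinset => (volume : Measure (FluctV N)))) ≠ ⊤ ∧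
            ∀ ω, ENNReal.ofReal ((WtOfRecord₁₃H F N θ p s).w j (s.init.Λ (j + 1)) ((s.init.Λ (j + 1))ᶜ ∩ s.init.Ω (j + 1)) (S (j + 1)) ω) ≤
              ŵ (fun b : ↥(Set.toFinite (B10Eq42TorusConstraint.bondsIn j ((s.init.Λ (j + 1))ᶜ ∩ s.init.Ω (j + 1)))).toFinset => (ω j).2 b)) →
        (slotsTOfRecord F N θ.ν θ.τ9 (EOfRecord₁₃ F N θ.toStage13Params) (wOfRecord₉ F N θ.toStage9Params) θ.ppSel p
            (gOfRecord₁₃ F N θ.toStage13Params p) (k + 1) s = 0 ∨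
          ∀ᵐ V' ∂fieldMeasure (F.P p.K) (k + 1) (SU N),
            chiSeqOfRecord F N θ.ν θ.τ9.M (gOfRecord₁₃ F N θ.toStage13Params p) p.K (k + 1) s V' ≠ 0 →
              slotsTOfRecord F N θ.ν θ.τ9 (EOfRecord₁₃ F N θ.toStage13Params) (wOfRecord₉ F N θ.toStage9Params) θ.ppSel p
                  (gOfRecord₁₃ F N θ.toStage13Params p) (k + 1) s V' =
                sect2Slot F N (FluctV N) p.K (settingOfRecord₁₃ F N θ.toStage13Params p) (θ.rzAt p s) (WtOfRecord₁₃H F N θ p s) s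
                  (spaceTruncR (settingOfRecord₁₃ F N θ.toStage13Params p) k (truncTermValues k (t₀ s.init))) (E₀ s.init)
                  (UbgOfRecord₁₃CoP F N θ.toStage13Params p (k + 1) s) V') := by
  -- g10's fluctuation truncation at level `k`, then the space truncation with retracted boundary terms, the background read at charged indices only
  have hform₁ := hasSect2FormAtZS_truncTermValues (settingOfRecord₁₃ F N θ.toStage13Params p) (Nat.le_succ k) (θ.rzAt p) (WtOfRecord₁₃H F N θ p)
    (UbgOfRecord₁₃CoP F N θ.toStage13Params p k) _ _
    (fun s₀ t' ht' => lawsRT_truncTermValues (settingOfRecord₁₃ F N θ.toStage13Params p) (θ.rzAt p s₀) s₀.Ω t' _ k k ht') hform₀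
  have hg : ∀ j, 1 ≤ j → j ≤ k → 0 ≤ (settingOfRecord₁₃ F N θ.toStage13Params p).flow.g (j - 1) ∧
      (settingOfRecord₁₃ F N θ.toStage13Params p).flow.g (j - 1) ≤ (settingOfRecord₁₃ F N θ.toStage13Params p).lf.γ :=
    fun j _ hj => ⟨(hw (j - 1) (by omega)).1.le, (hw (j - 1) (by omega)).2⟩
  have h1 : ∀ (s₀ : SeqOfRecord F θ.ν θ.τ9.M (gOfRecord₁₃ F N θ.toStage13Params p) p.K k) (j : ℕ), 1 ≤ j → j ≤ k →
      ∀ X : (Sect2.domSys (F.P p.K) θ.τ9.M j).Dom,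
      Sect2.ofBackgroundC (settingOfRecord₁₃ F N θ.toStage13Params p).ι (1 : GaugeField (F.P p.K) 0 (SU N)) ∈
        Sect2.spaceI (settingOfRecord₁₃ F N θ.toStage13Params p) (θ.rzAt p s₀) θ.τ9.M j (Sect2.domSites (F.P p.K) θ.τ9.M j X)
          ((settingOfRecord₁₃ F N θ.toStage13Params p).lf.alpha0 ((settingOfRecord₁₃ F N θ.toStage13Params p).flow.g j))
          ((settingOfRecord₁₃ F N θ.toStage13Params p).lf.alpha1 ((settingOfRecord₁₃ F N θ.toStage13Params p).flow.g j)) :=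
    fun s₀ j _ hj X => Sect2.one_mem_spaceI _ (settingOfRecord₁₃_pos F N θ.toStage13Params hpos p).cB_pos (h.rzAtLaws p s₀) θ.τ9.M j _
      (alphaPos₁₃_of_inInterval hθ hw hj).1 (alphaPos₁₃_of_inInterval hθ hw hj).2
  have hformT := hasSect2FormAtZS_spaceTruncR_of_charged_fibre (settingOfRecord₁₃ F N θ.toStage13Params p) (le_refl k) (θ.rzAt p) (WtOfRecord₁₃H F N θ p)
    (UbgOfRecord₁₃CoP F N θ.toStage13Params p k) _
    (fun s₀ j U₀ => PlaqSmallOn (plaqsOf (pts j (Γr s₀ j (s₀.Ω (j + 1))ᶜ))) (cR * epsOfRecord θ.ν (gOfRecord₁₃ F N θ.toStage13Params p) j) U₀)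
    (fun s₀ j _ ω hz => plaqSmallOn_readOn_of_zetaP_ne_zero (hreg s₀) s₀.Ω j hz) hg h1
    (fun s₀ hs Wc hχ hR hoff hfb j h1j hjk X => hbg s₀ Wc ⟨hs, hχ, hR, hoff, hfb⟩ j h1j hjk X) hform₁
  refine ⟨hformT, fun s hΩ hpre hZ hq hqloc hζm hqm hW => ?_⟩
  refine clause_succ_CoPH_of_Omega_empty_of_pinChi_of_oldBranch_of_clause_of_graph θ p h hk hM s hΩ hqloc hpre
    (spaceTruncR (settingOfRecord₁₃ F N θ.toStage13Params p) k (truncTermValues k (t₀ s.init))) (E₀ s.init)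
    (fun S a a' Uf ha => action23_sect2ActionDataOfRecord_congr_fluct_of_isFluctLocal p.K _ _ s.init
      (isFluctLocal_spaceTruncR (isFluctLocal_truncTermValues k (t₀ s.init)) _ k) (E₀ s.init) S a a' ha Uf)
    (hformT.2 s.init).2 hZ hq fun S hSm => ?_
  choose ŵ hŵm hŵfin hdom using hW S hSm
  haveI : BorelSpace (GaugeField (F.P p.K) 0 (SU N)) := inferInstanceAs (BorelSpace (PBond (F.P p.K) 0 → SU N))
  have hcont : Continuous fun U : GaugeField (F.P p.K) 0 (SU N) => Sect2.ofBackgroundC (settingOfRecord₁₃ F N θ.toStage13Params p).ι U :=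
    continuous_ofBackgroundC_ιSU
  have hΦm := measurable_sect2Operand_of_termRows p.K (settingOfRecord₁₃ F N θ.toStage13Params p) (θ.rzAt p s.init) s.init
    (spaceTruncR (settingOfRecord₁₃ F N θ.toStage13Params p) k (truncTermValues k (t₀ s.init))) (E₀ s.init)
    (measurable_UbgOfRecord₁₃CoP F N θ.toStage13Params p k s.init) S
    (fun j X z g' => measurable_re_spaceTrunc_E_comp _ k (truncTermValues k (t₀ s.init)) hcont j X z g')
    (fun j X => measurable_re_spaceTrunc_R_comp _ k (truncTermValues k (t₀ s.init)) hcont j X)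
    (fun j X => measurable_re_spaceTruncR_B_comp_of_borel_pos _ k (truncTermValues k (t₀ s.init)) j X (fl := fun a : MSFluct (F.P p.K) (FluctV N) => (S, a))
      (fun h1j hjk => measurable_B_truncTermValues_of_borel (t₀ s.init) k j X S (hBt s.init S j X h1j hjk)))
  obtain ⟨CE, hCE⟩ := exists_bound_spaceTrunc_E (settingOfRecord₁₃ F N θ.toStage13Params p) k (truncTermValues k (t₀ s.init))
  obtain ⟨CR, hCR⟩ := exists_bound_spaceTrunc_R (settingOfRecord₁₃ F N θ.toStage13Params p) k (truncTermValues k (t₀ s.init))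
  obtain ⟨CB, hCB⟩ := exists_bound_spaceTruncR_B (settingOfRecord₁₃ F N θ.toStage13Params p) k (truncTermValues k (t₀ s.init))
  obtain ⟨CΦ, hΦle⟩ := exists_bound_sect2Operand_of_termBounds p.K (settingOfRecord₁₃ F N θ.toStage13Params p) (θ.rzAt p s.init) s.init
    (spaceTruncR (settingOfRecord₁₃ F N θ.toStage13Params p) k (truncTermValues k (t₀ s.init))) (E₀ s.init) (UbgOfRecord₁₃CoP F N θ.toStage13Params p k s.init)
    ⟨CE, fun j X z g' U => hCE j X z g' _⟩ ⟨CR, fun j X U => hCR j X _⟩ ⟨CB, fun j X U a => hCB j X _ a⟩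
  exact integrable_oldBranch_of_dominated θ p h.zhLaws hU s S hζm hqm ŵ hŵm
    (fun j => (∫⁻ a, ŵ j a ∂(Measure.pi fun _ : ↥(Set.toFinite (B10Eq42TorusConstraint.bondsIn j ((s.init.Λ (j + 1))ᶜ ∩ s.init.Ω (j + 1)))).toFinset => (volume : Measure (FluctV N)))).toNNReal)
    (fun j => le_of_eq (ENNReal.coe_toNNReal (hŵfin j)).symm) hdom
    (Φ := sect2Operand F N (FluctV N) p.K (settingOfRecord₁₃ F N θ.toStage13Params p) (θ.rzAt p s.init) s.init
      (spaceTruncR (settingOfRecord₁₃ F N θ.toStage13Params p) k (truncTermValues k (t₀ s.init))) (E₀ s.init) (UbgOfRecord₁₃CoP F N θ.toStage13Params p k s.init))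
    hΦm (fun a U => (sect2Operand_pos p.K _ _ s.init _ (E₀ s.init) _ a U).le) CΦ hΦle

end Record

/-! ## §3  (γ′) on the fibres -/

section SameWitness


variable {F : T4Family} {N : ℕ} [NeZero N]

variable (θ : Stage13HParams F N) (p : B12.RunParams)

/-- **★★★★ (γ′, fibre edition) THE NO-EXPANSION 𝐓-STEP CLAUSE FOR THE GIVEN WITNESS ITSELF, background provisos on the CHARGED ITERATED FIBRES** (parents AND children): from a named `(t₀, E₀)` with the §2 form at index `k` and Borel
𝐁-terms on `[1, k]`, the level-`k` rows of p594941 (charged reading support), and — per no-expansion child `s′` — 12a″'s `RegOn (Γr' s′)` of the residual serving `s′` and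
def-R's `BgProvisoΛ` at the level-`(k+1)` background over the child's CHARGED reading support, the clause holds with right side `sect2Slot … s′ (t₀ (init s′)) (E₀ (init s′)) …`
— NO truncation, no `∃`.  (The truncated family serves the level-`k` transport only; at the child it is traded back for `t₀` by §2.) [cite: Balaban1988Convergent, Theorem p.245, Thm 1 p.262, (2.10) p.256, (2.18) p.257, (2.20)–(2.28) pp.258–259, (2.41)–(2.42) p.261, (3.24)–(3.25) p.270; Balaban1989LargeFieldI, (0.2)–(0.3) p.176] -/
theorem clause_succ_sameWitness_of_hasSect2FormAtZS_of_borelB_of_bgReadChargedFibre (h : θ.Provisos₁₃CoPH F N) (hU : θ.ZhUnity F N)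
    (hθ : θ.Admissible F N) (hpos : θ.s2.Pos) {k : ℕ} (hk : k < p.K) (hM : 1 ≤ θ.τ9.M) (hw : Step.InInterval θ.γ k (gOfRecord₁₃ F N θ.toStage13Params p))
    (cR : ℝ) (Γr : SeqOfRecord F θ.ν θ.τ9.M (gOfRecord₁₃ F N θ.toStage13Params p) p.K k → ℕ → Set (Site (F.P p.K) 0) → Set (Site (F.P p.K) 0))
    (hreg : ∀ s₀, (θ.zhAt p s₀).RegOn F N (FluctV N) θ.ν cR p (gOfRecord₁₃ F N θ.toStage13Params p) (Γr s₀))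
    (hbg : BgProvisoΛ F N p.K (settingOfRecord₁₃ F N θ.toStage13Params p) (θ.Rz p.K) θ.τ9.M k
      (fun s₀ => {Wc | slotsOfRecord F N θ.ν θ.τ9 (EOfRecord₁₃ F N θ.toStage13Params) (wOfRecord₉ F N θ.toStage9Params) θ.ppSel p
          (gOfRecord₁₃ F N θ.toStage13Params p) k s₀ ≠ 0 ∧
        chiSeqOfRecord F N θ.ν θ.τ9.M (gOfRecord₁₃ F N θ.toStage13Params p) p.K k s₀ (Wc k) ≠ 0 ∧
        (∀ j, j < k → PlaqSmallOn (plaqsOf (pts j (Γr s₀ j (s₀.Ω (j + 1))ᶜ))) (cR * epsOfRecord θ.ν (gOfRecord₁₃ F N θ.toStage13Params p) j) (Wc j)) ∧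
        (∀ j, j < k → ∀ b : PBond (F.P p.K) j, b ∉ bondsIn j (s₀.Ω (j + 1))ᶜ → Wc j b = 1) ∧
        (∀ j, j < k → ∀ b : PBond (F.P p.K) (j + 1), b ∈ bondsIn (j + 1) (s₀.Ω (j + 1))ᶜ → (avOfRecord F N p.K j).avg (Wc j) b = Wc (j + 1) b)})
      (UbgOfRecord₁₃CoP F N θ.toStage13Params p k))
    (t₀ : SeqOfRecord F θ.ν θ.τ9.M (gOfRecord₁₃ F N θ.toStage13Params p) p.K k → Sect2.TermValues (F.P p.K) (MatA N) (FluctV N) θ.τ9.M)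
    (E₀ : SeqOfRecord F θ.ν θ.τ9.M (gOfRecord₁₃ F N θ.toStage13Params p) p.K k → ℝ)
    (hform₀ : HasSect2FormAtZS F N (FluctV N) p.K (settingOfRecord₁₃ F N θ.toStage13Params p) k (θ.rzAt p) (WtOfRecord₁₃H F N θ p)
      (UbgOfRecord₁₃CoP F N θ.toStage13Params p k)
      (fun s₀ t' => Sect2.LawsRT (sect2TowerOfRecord F N (FluctV N) p.K (settingOfRecord₁₃ F N θ.toStage13Params p) (θ.rzAt p s₀) s₀ t')
        (settingOfRecord₁₃ F N θ.toStage13Params p).lf k)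
      (slotsOfRecord F N θ.ν θ.τ9 (EOfRecord₁₃ F N θ.toStage13Params) (wOfRecord₉ F N θ.toStage9Params) θ.ppSel p (gOfRecord₁₃ F N θ.toStage13Params p) k) t₀ E₀)
    (hBt : ∀ s₀ (S' : ℕ → Set (Site (F.P p.K) 0)) (j : ℕ) (X : (Sect2.domSys (F.P p.K) θ.τ9.M j).Dom), 1 ≤ j → j ≤ k →
      Measurable (fun q : GaugeField (F.P p.K) 0 (SU N) × MSFluct (F.P p.K) (FluctV N) =>
        (t₀ s₀).B j X (Sect2.ofBackgroundC (settingOfRecord₁₃ F N θ.toStage13Params p).ι q.1) (S', q.2)))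
    -- AT THE CHILDREN (length `k+1`): 12a″'s reading law of the residual serving the child, and def-R's proviso over the child's CHARGED reading support
    (Γr' : SeqOfRecord F θ.ν θ.τ9.M (gOfRecord₁₃ F N θ.toStage13Params p) p.K (k + 1) → ℕ → Set (Site (F.P p.K) 0) → Set (Site (F.P p.K) 0))
    (hreg' : ∀ s, (θ.zhAt p s).RegOn F N (FluctV N) θ.ν cR p (gOfRecord₁₃ F N θ.toStage13Params p) (Γr' s))
    (hbg' : BgProvisoΛ F N p.K (settingOfRecord₁₃ F N θ.toStage13Params p) (θ.Rz p.K) θ.τ9.M k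
      (fun s : SeqOfRecord F θ.ν θ.τ9.M (gOfRecord₁₃ F N θ.toStage13Params p) p.K (k + 1) =>
        {Wc | slotsTOfRecord F N θ.ν θ.τ9 (EOfRecord₁₃ F N θ.toStage13Params) (wOfRecord₉ F N θ.toStage9Params) θ.ppSel p
            (gOfRecord₁₃ F N θ.toStage13Params p) (k + 1) s ≠ 0 ∧
          chiSeqOfRecord F N θ.ν θ.τ9.M (gOfRecord₁₃ F N θ.toStage13Params p) p.K (k + 1) s (Wc (k + 1)) ≠ 0 ∧
          (∀ j, j < k + 1 → PlaqSmallOn (plaqsOf (pts j (Γr' s j (s.Ω (j + 1))ᶜ))) (cR * epsOfRecord θ.ν (gOfRecord₁₃ F N θ.toStage13Params p) j) (Wc j)) ∧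
          (∀ j, j < k + 1 → ∀ b : PBond (F.P p.K) j, b ∉ bondsIn j (s.Ω (j + 1))ᶜ → Wc j b = 1) ∧
          (∀ j, j < k + 1 → ∀ b : PBond (F.P p.K) (j + 1), b ∈ bondsIn (j + 1) (s.Ω (j + 1))ᶜ → (avOfRecord F N p.K j).avg (Wc j) b = Wc (j + 1) b)})
      (UbgOfRecord₁₃CoP F N θ.toStage13Params p (k + 1))) :
    ∀ (s : SeqOfRecord F θ.ν θ.τ9.M (gOfRecord₁₃ F N θ.toStage13Params p) p.K (k + 1)), s.Ω (k + 1) = ∅ →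
        -- (P) prefix agreement below `k`
        (∀ j, j < k → (θ.zhAt p s).ζ0 j = (θ.zhAt p s.init).ζ0 j ∧ (θ.zhAt p s).quad j = (θ.zhAt p s.init).quad j) →
        -- (V) the generation-`k` pin with the old front factor
        (∀ (V' : GaugeField (F.P p.K) (k + 1) (SU N)) (U₀ : GaugeField (F.P p.K) k (SU N)),
          (θ.zhAt p s).ζ0 k Set.univ (pairCfgAt (V := FluctV N) k V' U₀) =
            chiSeqOfRecord F N θ.ν θ.τ9.M (gOfRecord₁₃ F N θ.toStage13Params p) p.K k s.init U₀ *
              wOfRecord₉ F N θ.toStage9Params p (gOfRecord₁₃ F N θ.toStage13Params p) k s U₀ ((avOfRecord F N p.K k).avg U₀)) →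
        -- `quad_k(∅) = 0` on the two-scale configurations
        (∀ (V' : GaugeField (F.P p.K) (k + 1) (SU N)) (U₀ : GaugeField (F.P p.K) k (SU N)), (θ.zhAt p s).quad k ∅ (pairCfgAt (V := FluctV N) k V' U₀) = 0) →
        -- `k`-locality of `quad_j(Λ_{j+1})`, `j < k`
        (∀ j, j < k → ∀ ω ω' : MultiCfg (F.P p.K) (SU N) (FluctV N), (∀ i, i ≤ k → ω i = ω' i) →
          (θ.zhAt p s).quad j (s.init.Λ (j + 1)) ω = (θ.zhAt p s).quad j (s.init.Λ (j + 1)) ω') →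
        -- measurability of the residual serving `s′`
        (∀ j (Y : Set (Site (F.P p.K) 0)), Measurable ((θ.zhAt p s).ζ0 j Y)) →
        (∀ j (Λ' : Set (Site (F.P p.K) 0)), Measurable ((θ.zhAt p s).quad j Λ')) →
        -- per old branch: A-fibre domination (K0b)
        (∀ S ∈ admSOfRecord F θ.ν θ.τ9.M (gOfRecord₁₃ F N θ.toStage13Params p) p.K k s.init, ∀ j : ℕ,
          ∃ ŵ : (↥(Set.toFinite (B10Eq42TorusConstraint.bondsIn j ((s.init.Λ (j + 1))ᶜ ∩ s.init.Ω (j + 1)))).toFinset → FluctV N) → ℝ≥0∞, Measurable ŵ ∧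
            (∫⁻ a, ŵ a ∂(Measure.pi fun _ : ↥(Set.toFinite (B10Eq42TorusConstraint.bondsIn j ((s.init.Λ (j + 1))ᶜ ∩ s.init.Ω (j + 1)))).toFinset => (volume : Measure (FluctV N)))) ≠ ⊤ ∧
            ∀ ω, ENNReal.ofReal ((WtOfRecord₁₃H F N θ p s).w j (s.init.Λ (j + 1)) ((s.init.Λ (j + 1))ᶜ ∩ s.init.Ω (j + 1)) (S (j + 1)) ω) ≤
              ŵ (fun b : ↥(Set.toFinite (B10Eq42TorusConstraint.bondsIn j ((s.init.Λ (j + 1))ᶜ ∩ s.init.Ω (j + 1)))).toFinset => (ω j).2 b)) →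
        (slotsTOfRecord F N θ.ν θ.τ9 (EOfRecord₁₃ F N θ.toStage13Params) (wOfRecord₉ F N θ.toStage9Params) θ.ppSel p
            (gOfRecord₁₃ F N θ.toStage13Params p) (k + 1) s = 0 ∨
          ∀ᵐ V' ∂fieldMeasure (F.P p.K) (k + 1) (SU N),
            chiSeqOfRecord F N θ.ν θ.τ9.M (gOfRecord₁₃ F N θ.toStage13Params p) p.K (k + 1) s V' ≠ 0 →
              slotsTOfRecord F N θ.ν θ.τ9 (EOfRecord₁₃ F N θ.toStage13Params) (wOfRecord₉ F N θ.toStage9Params) θ.ppSel p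
                  (gOfRecord₁₃ F N θ.toStage13Params p) (k + 1) s V' =
                sect2Slot F N (FluctV N) p.K (settingOfRecord₁₃ F N θ.toStage13Params p) (θ.rzAt p s) (WtOfRecord₁₃H F N θ p s) s
                  (t₀ s.init) (E₀ s.init) (UbgOfRecord₁₃CoP F N θ.toStage13Params p (k + 1) s) V') := by
  obtain ⟨hformT, hcl⟩ := hasSect2FormAtZS_spaceTruncR_and_clause_succ_of_borelB_of_bgReadChargedFibre θ p h hU hθ hpos hk hM hw cR Γr hreg hbg
    t₀ E₀ hform₀ hBt
  intro s hΩ hpre hZ hq hqloc hζm hqm hW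
  by_cases hch : slotsTOfRecord F N θ.ν θ.τ9 (EOfRecord₁₃ F N θ.toStage13Params) (wOfRecord₉ F N θ.toStage9Params) θ.ppSel p
      (gOfRecord₁₃ F N θ.toStage13Params p) (k + 1) s = 0
  · exact Or.inl hch
  rcases hcl s hΩ hpre hZ hq hqloc hζm hqm hW with h0 | hae
  · exact Or.inl h0
  refine Or.inr ?_
  -- the window and the vacuum in the spaces (at the parent's residual)
  have hg : ∀ j, 1 ≤ j → j ≤ k → 0 ≤ (settingOfRecord₁₃ F N θ.toStage13Params p).flow.g (j - 1) ∧
      (settingOfRecord₁₃ F N θ.toStage13Params p).flow.g (j - 1) ≤ (settingOfRecord₁₃ F N θ.toStage13Params p).lf.γ :=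
    fun j _ hj => ⟨(hw (j - 1) (by omega)).1.le, (hw (j - 1) (by omega)).2⟩
  have h1 : ∀ j, 1 ≤ j → j ≤ k → ∀ X : (Sect2.domSys (F.P p.K) θ.τ9.M j).Dom,
      Sect2.ofBackgroundC (settingOfRecord₁₃ F N θ.toStage13Params p).ι (1 : GaugeField (F.P p.K) 0 (SU N)) ∈
        Sect2.spaceI (settingOfRecord₁₃ F N θ.toStage13Params p) (θ.rzAt p s.init) θ.τ9.M j (Sect2.domSites (F.P p.K) θ.τ9.M j X)
          ((settingOfRecord₁₃ F N θ.toStage13Params p).lf.alpha0 ((settingOfRecord₁₃ F N θ.toStage13Params p).flow.g j))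
          ((settingOfRecord₁₃ F N θ.toStage13Params p).lf.alpha1 ((settingOfRecord₁₃ F N θ.toStage13Params p).flow.g j)) :=
    fun j _ hj X => Sect2.one_mem_spaceI _ (settingOfRecord₁₃_pos F N θ.toStage13Params hpos p).cB_pos (h.rzAtLaws p s.init) θ.τ9.M j _
      (alphaPos₁₃_of_inInterval hθ hw hj).1 (alphaPos₁₃_of_inInterval hθ hw hj).2
  have hΛ := seq_init_Λ_eq_of_Omega_empty s hΩ
  have hΩ' := seq_init_Ω_eq_of_Omega_empty s hΩ
  filter_upwards [hae, sect2Slot_succ_spaceTruncR_truncTermValues_ae_eq_fibre (settingOfRecord₁₃ F N θ.toStage13Params p) (θ.rzAt p s) (θ.rzAt p s.init) hM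
    (WtOfRecord₁₃H F N θ p s) s hΩ
    (fun j U₀ => PlaqSmallOn (plaqsOf (pts j (Γr' s j (s.Ω (j + 1))ᶜ))) (cR * epsOfRecord θ.ν (gOfRecord₁₃ F N θ.toStage13Params p) j) U₀)
    (fun j _ ω hz => plaqSmallOn_readOn_of_zetaP_ne_zero (hreg' s) s.Ω j hz) (t₀ s.init) (E₀ s.init) _ (hform₀.2 s.init).1 hg h1] with V' hV' hchild hχ
  rw [hV' hχ]
  refine hchild fun Wc hW hR hoff hfib j h1j hjk X => ?_
  rw [hΛ, hΩ']
  exact hbg' s Wc ⟨hch, by rw [hW]; exact hχ, hR, hoff, hfib⟩ j h1j hjk X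

end SameWitness

end Summit.QuantumFields.YangMills.Theorems.BalabanUVNodesN11SpaceTruncationSameWitnessFibre

end
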